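import Summits.QuantumFields.BalabanUV.Beta.GAN24.VertexFacePushOfWardLetters
import Summits.QuantumFields.BalabanUV.Beta.GAN24.FourFaceSourceWordsDeep

/-!
# `BalabanUV.Beta.GAN24.FaceChargesOfWardLetters` — binder row G-an2-4 ∕ (CONV-C), TRANSFER-III («slot the chain», the OWNER gan24-p1's `TRANSFER-III-SIZING.v0_7.md` §3(a),
# second option; R-gan24p1-g46-2): **leaf-06 K6b (THE WEIGHTED TWO-FACE READ-OUT OF `K3OfK`) AND MY Part 47 (K6c AT EVERY COARSE PERIOD) FOR ANY PACKED KERNEL CARRYING THE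
# LETTERS (DG)(W-H)(W-M)(SG)(MO)** — leaf-06 g54's `DressedStepFaceChargesWeighted` §1–§2 and MY Part 47 `FourFaceSourceWordsDeep.faceRead_dressedSource_inl_inl` RE-CUT OVER A
# GENERIC KERNEL `X` WITH DISPLAYED LETTERS, and the instance at the COMB-CHART dressed step `X̃′_j := unitK s_f s_m (GcombSh Lc j)` of row D1's literal of record (III′)
# (G-an2-4 CRUX TEAM (2), leaf prover `b2b-balaban-gan24-formalise-leaf-02`, gen 78)

NOT IN PRINT; OUR BOOKKEEPING ([folklore] BY NAME over `VertexFacePushOfWardLetters.hasSum_col_coordWeight_of_ward` and `ColumnResponseOfWardLetters.hasSum_coord_colM_of_ward` (this gen),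
leaf-06 K6a `SandwichReadoutWeighted.hasSum_mmRead_K3OfK_weight` (generic kernel, hypothesised charges), leaf-06 K6c `FourFaceSourceWords.ite_and_and_eq ∕ sum_elim_and_charges`, MY Part 47
`deepMask_eq`, an4's `OneStepResolventKernel.eq_zsmul_quo_of_proj`, leaf-02 g53 `LayerCommutatorAntisymm.trK_unitK_eq_sgnK` and, for the instance, an2's (III′) letters
`CombChartHColumnWard.colH_ward_GcombSh`, `CombChartWardSockets.colM_GcombSh_ward ∕ trK_GcombSh ∕ GcombSh_inr_inr_off`, `CombChartStepJets.decays_GcombSh`; 0 `def`, 0 cited fact,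
0 `def … : Prop`, 0 sorry).  HONEST FRAMING (cell contract, verbatim): «discharging `BetaPertH` makes Bałaban's UV stability UNCONDITIONAL — a real constructive-QFT result; it is NOT
the continuum limit and NOT the Clay problem.»  HONEST DEPENDENCY (verbatim): «continuum YM on T⁴ ⇐ BetaPertH ∧ nine spine estimates (0/9 proved); BetaPertH ⇐ (D1) ∧ (D4) ∧ CAP+tail;
G-an2-4 gates asym, D1 and NE2/3/4.»

WHY.  The FIRST word of the T6-STEP supplier chain (the `P`-face read of the dressed one-step source, MY Part 47 over leaf-06 K6b) reads the dressed step `X̃ = unitK s_f s_m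
(coDressKBmAt ρ Lc (KInvStep Lc j))` through five letters: (DG) decay, (W-H) the `ℋ`-column Ward law, (W-M) the multiplier-column Ward law, (SG) `trK X̃ = sgnK X̃`, (MO) the multiplier
rows vanish off the coarse lattice.  This file proves K6b §1–§2 and Part 47 ONCE over the letters (ONE constant `cH` for (E)'s `(s_f s_m)·cH_j`); §3 = the (III′) instance.

WHAT (generic `d`, `Lc ≥ 1`; `X : MKer (d+1) (Fib d)`; letters (DG) `Decays X C m`, `m > 0`; (W-H) `Σ_μ (colH X Lc μ (y − e_μ) κ u − colH X Lc μ y κ u) = cH·gaugeWt Lc y κ u`;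
(W-M) `Σ_μ (colM X Lc μ (y − e_μ) ρ w − colM X Lc μ y ρ w) = 0`; (SG) `trK X = sgnK X`; (MO) `Torus.proj Lc w ≠ 0 → X w z (inr ρ) (inr μ) = 0`):
* §1 (K6b §1–§2): `inr_row_eq_of_sgn` (rows from columns), `hasSum_row_coordWeight_inl_of_ward` (`−𝟙[a = α ∧ y_α exit]·cH·f(⌊y_α∕Lc⌋)`), `hasSum_col_coordWeight_inl_of_ward`,
  `hasSum_row_weight_inr_of_ward` ∕ `hasSum_col_weight_inr_of_ward` (`0`), `hasSum_row_weight_of_ward` ∕ `hasSum_col_weight_of_ward` (both fibres), **`hasSum_mmRead_K3OfK_weight_of_ward`**.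
* §2 (Part 47): `readout_eq_deepFF_const` (any constant `K`: the read-out word at the period-`P` face weights is `−K²·` the two-face word at the exit class of period `Lc·P`),
  **`faceRead_source_inl_inl_of_ward`** (the `P`-face read of `c•mmRead Lc (K3OfK X Lc S M W …) + cB•B` = `c·(−cH²)·Σ_{r′,u′}[faces]·(direct + swapped − W)`).
* §3 THE (III′) INSTANCE `X̃′_j := unitK s_f s_m (GcombSh Lc j)` (ANY units, every `j`; no in-block-root hypothesis; constant `s_f·s_m·cH_j`): `trK_combStep`, `combStep_inr_inr_off`,
  **`hasSum_mmRead_K3OfK_combStep_weight`**, **`faceRead_combSource_inl_inl`** — the (III′) twins of K6b §2 and Part 47.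
Asserts NO value of any table; discharges NOTHING of (C) ∕ (C)sym ∕ `hstep` ∕ `hSrc` ∕ `hSrcX` ∕ (Q-L) ∕ `(hS, hSall)` ∕ `(hW, hWall)` at (E) or (III′); NEVER «G-an2-4 closed» as (CONV-C);
NOT D1, NOT `BetaPertH`, NOT continuum, NOT Clay.  2026-08-25; no existing file touched.
-/

noncomputable section

open Finset
open scoped BigOperators
open Literature.MathematicalPhysics.QuantumFieldTheory
open Literature.MathematicalPhysics.QuantumFieldTheory.Balaban1983to89
open Literature.MathematicalPhysics.QuantumFieldTheory.Balaban1983to89.Beta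
open Literature.Probability.LatticeModels (Torus.proj)
open B6BondElimination (unitVec)
open ExpKernelCalculus (Site MKer Decays comp)
open LatticeForm (quo)
open OneStepResolventKernel (Fib eq_zsmul_quo_of_proj)
open AffineAveraging (box toSite)
open AveragingContours (blk)
open AxialProjector (blk_zsmul)
open OneStepKernelFamily (colH)
open SecondOrderResponse (colM dM)
open BalabanStepW2 (K3OfK)
open BalabanStepJetsSucc (mmRead)
open Summit.QuantumFields.BalabanUV.Beta.TameKernelCalculus (Loc trK trK_apply)
open Summit.QuantumFields.BalabanUV.Beta.BorderedHessian (stepScale sgnF sgnF_inl sgnF_inr sgnK sgnK_apply)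
open Summit.QuantumFields.BalabanUV.Beta.KernelWardRelative (gaugeWt)
open Summit.QuantumFields.BalabanUV.Beta.HessKerDressedUnits (unitK decays_unitK)
open Summit.QuantumFields.BalabanUV.Beta.GAN24.BiStencilZeroMode (Tab)
open Summit.QuantumFields.BalabanUV.Beta.GAN24.SandwichReadoutWeighted (hasSum_mmRead_K3OfK_weight)
open Summit.QuantumFields.BalabanUV.Beta.GAN24.FourFaceSourceWords (ite_and_and_eq sum_elim_and_charges)
open Summit.QuantumFields.BalabanUV.Beta.GAN24.FourFaceSourceWordsDeep (deepMask_eq)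
open Summit.QuantumFields.BalabanUV.Beta.GAN24.LayerCommutatorAntisymm (trK_unitK_eq_sgnK)
open Summit.QuantumFields.BalabanUV.Beta.GAN24.ColumnResponseOfWardLetters (summable_colM_of_decays hasSum_coord_colM_of_ward colH_ward_unitK colM_ward_unitK)
open Summit.QuantumFields.BalabanUV.Beta.GAN24.VertexFacePushOfWardLetters (hasSum_col_coordWeight_of_ward)
open Summit.QuantumFields.BalabanUV.Beta.CombChartStepJets (GcombSh decays_GcombSh)
open Summit.QuantumFields.BalabanUV.Beta.CombChartHColumnWard (colH_ward_GcombSh)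
open Summit.QuantumFields.BalabanUV.Beta.CombChartWardSockets (colM_GcombSh_ward trK_GcombSh GcombSh_inr_inr_off)

namespace Summit.QuantumFields.BalabanUV.Beta.GAN24.FaceChargesOfWardLetters

variable {d : ℕ} {Lc : ℕ} [NeZero Lc]

/-! ## §1 The weighted coarse-leg charges of a kernel with the letters, and the weighted two-face read-out of `K3OfK` -/

section Ward

variable {X : MKer (d + 1) (Fib d)} {C m cH : ℝ}

omit [NeZero Lc] in
/-- [folklore] **ROWS FROM COLUMNS, FROM (SG)** (`Xᵀ = sgnK X`): `X x y (inr α) b = sgnF b · (−1) · X y x b (inr α)`. -/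
theorem inr_row_eq_of_sgn (hXsg : trK X = sgnK X) (x y : Site (d + 1)) (α : Fin (d + 1)) (b : Fib d) :
    X x y (Sum.inr α) b = -(sgnF b * X y x b (Sum.inr α)) := by
  have h := congrFun (congrFun (congrFun (congrFun hXsg y) x) b) (Sum.inr α)
  rw [trK_apply, sgnK_apply, sgnF_inr] at h
  rw [h]
  ring

/-- [folklore] **THE WEIGHTED ROW CHARGE ON A FIELD LEG, FROM (W-H)(SG)**: `Σ_{x′} f(x′_α)·X(Lc•x′, y)_{(inr α, inl a)} = −[a = α ∧ y_α % Lc = Lc−1]·cH·f(⌊y_α∕Lc⌋)`. -/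
theorem hasSum_row_coordWeight_inl_of_ward (hX : Decays X C m) (hm : 0 < m)
    (hHw : ∀ (y : Site (d + 1)) (κ : Fin (d + 1)) (u : Site (d + 1)),
      ∑ μ, (colH X Lc μ (y - unitVec μ) κ u - colH X Lc μ y κ u) = cH * gaugeWt Lc y κ u)
    (hXsg : trK X = sgnK X) (α : Fin (d + 1)) (f : ℤ → ℝ) {B : ℝ} (hf : ∀ s, |f s| ≤ B) (a : Fin (d + 1)) (y : Site (d + 1)) :
    HasSum (fun x' : Site (d + 1) => f (x' α) * X ((Lc : ℤ) • x') y (Sum.inr α) (Sum.inl a))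
      (if a = α ∧ y α % (Lc : ℤ) = (Lc : ℤ) - 1 then -(cH * f (blk Lc y α)) else 0) := by
  have hLc : 1 ≤ Lc := Nat.one_le_iff_ne_zero.2 (NeZero.ne Lc)
  have h := hasSum_col_coordWeight_of_ward hX hm hHw α f hf (Sum.inl a) y
  simp only [Sum.elim_inl, blk_zsmul hLc] at h
  have hv : (if a = α ∧ y α % (Lc : ℤ) = (Lc : ℤ) - 1 then -(cH * f (blk Lc y α)) else 0) =
      -(if a = α ∧ y α % (Lc : ℤ) = (Lc : ℤ) - 1 then cH * f (blk Lc y α) else 0) := by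
    split_ifs <;> simp
  rw [hv]
  refine h.neg.congr_fun fun x' => ?_
  show f (x' α) * X ((Lc : ℤ) • x') y (Sum.inr α) (Sum.inl a) = -(f (x' α) * X y ((Lc : ℤ) • x') (Sum.inl a) (Sum.inr α))
  rw [inr_row_eq_of_sgn hXsg, sgnF_inl]
  ring

/-- [folklore] **THE WEIGHTED COLUMN CHARGE ON A FIELD LEG, FROM (W-H)** (field fibre): `Σ_{z′} g(z′_β)·X(w, Lc•z′)_{(inl b, inr β)} = [b = β ∧ w_β % Lc = Lc−1]·cH·g(⌊w_β∕Lc⌋)`. -/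
theorem hasSum_col_coordWeight_inl_of_ward (hX : Decays X C m) (hm : 0 < m)
    (hHw : ∀ (y : Site (d + 1)) (κ : Fin (d + 1)) (u : Site (d + 1)),
      ∑ μ, (colH X Lc μ (y - unitVec μ) κ u - colH X Lc μ y κ u) = cH * gaugeWt Lc y κ u)
    (β : Fin (d + 1)) (g : ℤ → ℝ) {B : ℝ} (hg : ∀ s, |g s| ≤ B) (b : Fin (d + 1)) (w : Site (d + 1)) :
    HasSum (fun z' : Site (d + 1) => g (z' β) * X w ((Lc : ℤ) • z') (Sum.inl b) (Sum.inr β))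
      (if b = β ∧ w β % (Lc : ℤ) = (Lc : ℤ) - 1 then cH * g (blk Lc w β) else 0) := by
  have hLc : 1 ≤ Lc := Nat.one_le_iff_ne_zero.2 (NeZero.ne Lc)
  have h := hasSum_col_coordWeight_of_ward hX hm hHw β g hg (Sum.inl b) w
  simp only [Sum.elim_inl, blk_zsmul hLc] at h
  exact h

/-- [folklore] **THE WEIGHTED ROW SUM ON A MULTIPLIER LEG VANISHES, FROM (W-M)(SG)(MO)**: on the coarse lattice by `hasSum_coord_colM_of_ward`, off it by (MO) after (SG). -/
theorem hasSum_row_weight_inr_of_ward (hX : Decays X C m) (hm : 0 < m)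
    (hMw : ∀ (y : Site (d + 1)) (ρ : Fin (d + 1)) (w : Site (d + 1)), ∑ μ, (colM X Lc μ (y - unitVec μ) ρ w - colM X Lc μ y ρ w) = 0)
    (hXsg : trK X = sgnK X) (hXoff : ∀ (w z : Site (d + 1)) (ρ μ : Fin (d + 1)), Torus.proj Lc w ≠ 0 → X w z (Sum.inr ρ) (Sum.inr μ) = 0)
    (α : Fin (d + 1)) (f : ℤ → ℝ) {B : ℝ} (hf : ∀ s, |f s| ≤ B) (m' : Fin (d + 1)) (y : Site (d + 1)) :
    HasSum (fun x' : Site (d + 1) => f (x' α) * X ((Lc : ℤ) • x') y (Sum.inr α) (Sum.inr m')) 0 := by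
  classical
  by_cases hy : Torus.proj Lc y = 0
  · have e : ∀ x' : Site (d + 1), f (x' α) * X ((Lc : ℤ) • x') y (Sum.inr α) (Sum.inr m') = f (x' α) * colM X Lc α x' m' (quo Lc y) := by
      intro x'
      rw [inr_row_eq_of_sgn hXsg, sgnF_inr]
      conv_lhs => rw [eq_zsmul_quo_of_proj (N := Lc) hy]
      simp only [colM]
      ring
    simp_rw [e]
    exact hasSum_coord_colM_of_ward (summable_colM_of_decays hX hm) hMw α f hf m' (quo Lc y)
  · have e : ∀ x' : Site (d + 1), f (x' α) * X ((Lc : ℤ) • x') y (Sum.inr α) (Sum.inr m') = 0 := by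
      intro x'
      rw [inr_row_eq_of_sgn hXsg, hXoff y _ _ _ hy]
      ring
    simp_rw [e]
    exact hasSum_zero

/-- [folklore] The weighted column sum on a multiplier leg vanishes, from (W-M)(MO) (same mechanism, no transposition). -/
theorem hasSum_col_weight_inr_of_ward (hX : Decays X C m) (hm : 0 < m)
    (hMw : ∀ (y : Site (d + 1)) (ρ : Fin (d + 1)) (w : Site (d + 1)), ∑ μ, (colM X Lc μ (y - unitVec μ) ρ w - colM X Lc μ y ρ w) = 0)
    (hXoff : ∀ (w z : Site (d + 1)) (ρ μ : Fin (d + 1)), Torus.proj Lc w ≠ 0 → X w z (Sum.inr ρ) (Sum.inr μ) = 0)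
    (β : Fin (d + 1)) (g : ℤ → ℝ) {B : ℝ} (hg : ∀ s, |g s| ≤ B) (m' : Fin (d + 1)) (w : Site (d + 1)) :
    HasSum (fun z' : Site (d + 1) => g (z' β) * X w ((Lc : ℤ) • z') (Sum.inr m') (Sum.inr β)) 0 := by
  classical
  by_cases hw : Torus.proj Lc w = 0
  · have e : ∀ z' : Site (d + 1), g (z' β) * X w ((Lc : ℤ) • z') (Sum.inr m') (Sum.inr β) = g (z' β) * colM X Lc β z' m' (quo Lc w) := by
      intro z'
      conv_lhs => rw [eq_zsmul_quo_of_proj (N := Lc) hw]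
      simp only [colM]
    simp_rw [e]
    exact hasSum_coord_colM_of_ward (summable_colM_of_decays hX hm) hMw β g hg m' (quo Lc w)
  · have e : ∀ z' : Site (d + 1), g (z' β) * X w ((Lc : ℤ) • z') (Sum.inr m') (Sum.inr β) = 0 := fun z' => by
      rw [hXoff w _ _ _ hw, mul_zero]
    simp_rw [e]
    exact hasSum_zero

/-- [folklore] The weighted row charges on the fibre: field legs `inl a ↦ −[a=α]·[y_α exit]·cH·f(⌊y_α∕Lc⌋)`, multiplier legs `inr m ↦ 0`. -/
theorem hasSum_row_weight_of_ward (hX : Decays X C m) (hm : 0 < m)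
    (hHw : ∀ (y : Site (d + 1)) (κ : Fin (d + 1)) (u : Site (d + 1)),
      ∑ μ, (colH X Lc μ (y - unitVec μ) κ u - colH X Lc μ y κ u) = cH * gaugeWt Lc y κ u)
    (hMw : ∀ (y : Site (d + 1)) (ρ : Fin (d + 1)) (w : Site (d + 1)), ∑ μ, (colM X Lc μ (y - unitVec μ) ρ w - colM X Lc μ y ρ w) = 0)
    (hXsg : trK X = sgnK X) (hXoff : ∀ (w z : Site (d + 1)) (ρ μ : Fin (d + 1)), Torus.proj Lc w ≠ 0 → X w z (Sum.inr ρ) (Sum.inr μ) = 0)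
    (α : Fin (d + 1)) (f : ℤ → ℝ) {B : ℝ} (hf : ∀ s, |f s| ≤ B) (b : Fib d) (y : Site (d + 1)) :
    HasSum (fun x' : Site (d + 1) => f (x' α) * X ((Lc : ℤ) • x') y (Sum.inr α) b)
      (Sum.elim (fun a => if a = α ∧ y α % (Lc : ℤ) = (Lc : ℤ) - 1 then -(cH * f (blk Lc y α)) else 0) (fun _ => (0 : ℝ)) b) := by
  rcases b with a | m'
  · exact hasSum_row_coordWeight_inl_of_ward hX hm hHw hXsg α f hf a y
  · exact hasSum_row_weight_inr_of_ward hX hm hMw hXsg hXoff α f hf m' y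

/-- [folklore] **THE WEIGHTED COLUMN CHARGES ON THE FIBRE**: field legs `inl b ↦ +[b=β]·[w_β exit]·cH·g(⌊w_β∕Lc⌋)`, multiplier legs `inr m ↦ 0`. -/
theorem hasSum_col_weight_of_ward (hX : Decays X C m) (hm : 0 < m)
    (hHw : ∀ (y : Site (d + 1)) (κ : Fin (d + 1)) (u : Site (d + 1)),
      ∑ μ, (colH X Lc μ (y - unitVec μ) κ u - colH X Lc μ y κ u) = cH * gaugeWt Lc y κ u)
    (hMw : ∀ (y : Site (d + 1)) (ρ : Fin (d + 1)) (w : Site (d + 1)), ∑ μ, (colM X Lc μ (y - unitVec μ) ρ w - colM X Lc μ y ρ w) = 0)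
    (hXoff : ∀ (w z : Site (d + 1)) (ρ μ : Fin (d + 1)), Torus.proj Lc w ≠ 0 → X w z (Sum.inr ρ) (Sum.inr μ) = 0)
    (β : Fin (d + 1)) (g : ℤ → ℝ) {B : ℝ} (hg : ∀ s, |g s| ≤ B) (b : Fib d) (w : Site (d + 1)) :
    HasSum (fun z' : Site (d + 1) => g (z' β) * X w ((Lc : ℤ) • z') b (Sum.inr β))
      (Sum.elim (fun b' => if b' = β ∧ w β % (Lc : ℤ) = (Lc : ℤ) - 1 then cH * g (blk Lc w β) else 0) (fun _ => (0 : ℝ)) b) := by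
  rcases b with b' | m'
  · exact hasSum_col_coordWeight_inl_of_ward hX hm hHw β g hg b' w
  · exact hasSum_col_weight_inr_of_ward hX hm hMw hXoff β g hg m' w

/-- NOT IN PRINT; OUR BOOKKEEPING.  **THE TWO-FACE READ-OUT OF an2's `K3OfK` THROUGH A KERNEL WITH THE LETTERS, FACE-WEIGHTED COARSE LEGS** (bounded single-coordinate weights
`f(x′_α)`, `g(z′_β)`): with the weighted charges `ρL^f`, `ρR^g` of §1 and `R[V] := Σ'_{(y,w)} Σ_{φ,γ} ρL^f φ y·V y w φ γ·ρR^g γ w`,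
`Σ'_{(x′,z′)} f(x′_α)·g(z′_β)·(mmRead Lc (K3OfK X Lc S M W μ y ν y′))(x′,z′)_{αβ} = R[(dM_μ∘X)∘dM_ν] + R[(dM_ν∘X)∘dM_μ] − R[W_{μν}]` — leaf-06 K6a at the charges of §1; the generic
form of leaf-06 K6b `hasSum_mmRead_K3OfK_dressedStep_weight`. -/
theorem hasSum_mmRead_K3OfK_weight_of_ward (hX : Decays X C m) (hm : 0 < m)
    (hHw : ∀ (y : Site (d + 1)) (κ : Fin (d + 1)) (u : Site (d + 1)),
      ∑ μ, (colH X Lc μ (y - unitVec μ) κ u - colH X Lc μ y κ u) = cH * gaugeWt Lc y κ u)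
    (hMw : ∀ (y : Site (d + 1)) (ρ : Fin (d + 1)) (w : Site (d + 1)), ∑ μ, (colM X Lc μ (y - unitVec μ) ρ w - colM X Lc μ y ρ w) = 0)
    (hXsg : trK X = sgnK X) (hXoff : ∀ (w z : Site (d + 1)) (ρ μ : Fin (d + 1)), Torus.proj Lc w ≠ 0 → X w z (Sum.inr ρ) (Sum.inr μ) = 0)
    {S M : Fin (d + 1) → Site (d + 1) → MKer (d + 1) (Fib d)}
    {W : Fin (d + 1) → Site (d + 1) → Fin (d + 1) → Site (d + 1) → MKer (d + 1) (Fib d)} {μ ν : Fin (d + 1)} {y y' : Site (d + 1)}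
    (hb : Loc (dM X Lc S M μ y)) (hb' : Loc (dM X Lc S M ν y')) (hW : Loc (W μ y ν y')) (α β : Fin (d + 1))
    (f g : ℤ → ℝ) {Bf Bg : ℝ} (hf : ∀ s, |f s| ≤ Bf) (hg : ∀ s, |g s| ≤ Bg) :
    HasSum (fun xz : Site (d + 1) × Site (d + 1) =>
        f (xz.1 α) * g (xz.2 β) * mmRead Lc (K3OfK X Lc S M W μ y ν y') xz.1 xz.2 (Sum.inl α) (Sum.inl β))
      ((∑' yw : Site (d + 1) × Site (d + 1), ∑ φ' : Fib d, ∑ γ' : Fib d,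
          Sum.elim (fun a => if a = α ∧ yw.1 α % (Lc : ℤ) = (Lc : ℤ) - 1 then -(cH * f (blk Lc yw.1 α)) else 0) (fun _ => (0 : ℝ)) φ' *
            comp (comp (dM X Lc S M μ y) X) (dM X Lc S M ν y') yw.1 yw.2 φ' γ' *
          Sum.elim (fun b' => if b' = β ∧ yw.2 β % (Lc : ℤ) = (Lc : ℤ) - 1 then cH * g (blk Lc yw.2 β) else 0) (fun _ => (0 : ℝ)) γ') +
        (∑' yw : Site (d + 1) × Site (d + 1), ∑ φ' : Fib d, ∑ γ' : Fib d,
          Sum.elim (fun a => if a = α ∧ yw.1 α % (Lc : ℤ) = (Lc : ℤ) - 1 then -(cH * f (blk Lc yw.1 α)) else 0) (fun _ => (0 : ℝ)) φ' *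
            comp (comp (dM X Lc S M ν y') X) (dM X Lc S M μ y) yw.1 yw.2 φ' γ' *
          Sum.elim (fun b' => if b' = β ∧ yw.2 β % (Lc : ℤ) = (Lc : ℤ) - 1 then cH * g (blk Lc yw.2 β) else 0) (fun _ => (0 : ℝ)) γ') -
        ∑' yw : Site (d + 1) × Site (d + 1), ∑ φ' : Fib d, ∑ γ' : Fib d,
          Sum.elim (fun a => if a = α ∧ yw.1 α % (Lc : ℤ) = (Lc : ℤ) - 1 then -(cH * f (blk Lc yw.1 α)) else 0) (fun _ => (0 : ℝ)) φ' *
            W μ y ν y' yw.1 yw.2 φ' γ' *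
          Sum.elim (fun b' => if b' = β ∧ yw.2 β % (Lc : ℤ) = (Lc : ℤ) - 1 then cH * g (blk Lc yw.2 β) else 0) (fun _ => (0 : ℝ)) γ') :=
  hasSum_mmRead_K3OfK_weight (N := Lc) hX hm hb hb' hW α β (φ := fun x' => f (x' α)) (ψ := fun z' => g (z' β))
    (fun x' => hf (x' α)) (fun z' => hg (z' β))
    (ρL := fun b yy => Sum.elim (fun a => if a = α ∧ yy α % (Lc : ℤ) = (Lc : ℤ) - 1 then -(cH * f (blk Lc yy α)) else 0) (fun _ => (0 : ℝ)) b)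
    (ρR := fun b ww => Sum.elim (fun b' => if b' = β ∧ ww β % (Lc : ℤ) = (Lc : ℤ) - 1 then cH * g (blk Lc ww β) else 0) (fun _ => (0 : ℝ)) b)
    (fun b w => hasSum_row_weight_of_ward hX hm hHw hMw hXsg hXoff α f hf b w) (fun b w => hasSum_col_weight_of_ward hX hm hHw hMw hXoff β g hg b w)

/-! ## §2 Part 47 from the letters: the `P`-face read of the one-step source -/

omit [NeZero Lc] in
/-- [folklore] **THE READ-OUT WORD AT THE PERIOD-`P` FACE WEIGHTS IS `−K²` TIMES THE TWO-FACE WORD AT THE EXIT CLASS OF PERIOD `Lc·P`** (any constant `K`, any two-leg table `V`):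
`Σ'_{(y,w)} Σ_{f,g} ρL^χ f y·V y w f g·ρR^χ g w = −K²·Σ'_{(y,w)} [y_α % (Lc·P) = Lc·P−1]·[w_β % (Lc·P) = Lc·P−1]·V y w (inl α)(inl β)` (MY Part 47 `readout_eq_deepFF` with `K` for `(s_f s_m)·cH_j`). -/
theorem readout_eq_deepFF_const [NeZero Lc] {P : ℕ} (hP : 1 ≤ P) (K : ℝ) (α β : Fin (d + 1)) (V : MKer (d + 1) (Fib d)) :
    (∑' yw : Site (d + 1) × Site (d + 1), ∑ φ' : Fib d, ∑ γ' : Fib d,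
            Sum.elim (fun a => if a = α ∧ yw.1 α % (Lc : ℤ) = (Lc : ℤ) - 1 then -(K * (fun s : ℤ => if s % (P : ℤ) = (P : ℤ) - 1 then (1 : ℝ) else 0) (blk Lc yw.1 α)) else 0)
              (fun _ => (0 : ℝ)) φ' *
            V yw.1 yw.2 φ' γ' *
            Sum.elim (fun b' => if b' = β ∧ yw.2 β % (Lc : ℤ) = (Lc : ℤ) - 1 then K * (fun s : ℤ => if s % (P : ℤ) = (P : ℤ) - 1 then (1 : ℝ) else 0) (blk Lc yw.2 β) else 0)
              (fun _ => (0 : ℝ)) γ') =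
      -(K * K) * ∑' yw : Site (d + 1) × Site (d + 1),
        (if yw.1 α % ((Lc : ℤ) * (P : ℤ)) = (Lc : ℤ) * (P : ℤ) - 1 then (1 : ℝ) else 0) * (if yw.2 β % ((Lc : ℤ) * (P : ℤ)) = (Lc : ℤ) * (P : ℤ) - 1 then (1 : ℝ) else 0) *
          V yw.1 yw.2 (Sum.inl α) (Sum.inl β) := by
  classical
  have hLc : 0 < (Lc : ℤ) := by exact_mod_cast Nat.pos_of_ne_zero (NeZero.ne Lc)
  have hP0 : 0 < (P : ℤ) := by exact_mod_cast hP
  rw [← tsum_mul_left]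
  refine tsum_congr fun yw => ?_
  rw [sum_elim_and_charges]
  have hL : (if yw.1 α % (Lc : ℤ) = (Lc : ℤ) - 1 then -(K * (fun s : ℤ => if s % (P : ℤ) = (P : ℤ) - 1 then (1 : ℝ) else 0) (blk Lc yw.1 α)) else 0) =
      -(K * (if yw.1 α % ((Lc : ℤ) * (P : ℤ)) = (Lc : ℤ) * (P : ℤ) - 1 then (1 : ℝ) else 0)) := by
    rw [← deepMask_eq hLc hP0]
    simp only [blk]
    split_ifs <;> ring
  have hR : (if yw.2 β % (Lc : ℤ) = (Lc : ℤ) - 1 then K * (fun s : ℤ => if s % (P : ℤ) = (P : ℤ) - 1 then (1 : ℝ) else 0) (blk Lc yw.2 β) else 0) =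
      K * (if yw.2 β % ((Lc : ℤ) * (P : ℤ)) = (Lc : ℤ) * (P : ℤ) - 1 then (1 : ℝ) else 0) := by
    rw [← deepMask_eq hLc hP0]
    simp only [blk]
    split_ifs <;> ring
  rw [hL, hR]
  ring

/-- NOT IN PRINT; OUR BOOKKEEPING.  **THE FACE READ AT COARSE PERIOD `P` OF THE ONE-STEP SOURCE OF A KERNEL WITH THE LETTERS** (cell `box P`, bonds outside, legs inside, one conjunctive
exit-face mask at period `P`; `hb` ∕ `hW` localisation of the vertex and of the table, border `B` with zero ff block):
`Σ_{r′∈box P} Σ'_{u′} Σ'_x Σ'_z [r′_μ, u′_ν, x_α, z_β exit_P]·(c • mmRead Lc (K3OfK X Lc S M W μ r′ ν u′) + cB • B μ r′ ν u′) x z (inl α)(inl β)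
 = c·(−cH²)·Σ_{r′∈box P} Σ'_{u′} [r′_μ, u′_ν exit_P]·( FF^{Lc·P}[(dM_μ∘X)∘dM_ν] + FF^{Lc·P}[(dM_ν∘X)∘dM_μ] − FF^{Lc·P}[W_{μν}] )` — MY Part 47 token for token over §1. -/
theorem faceRead_source_inl_inl_of_ward (hX : Decays X C m) (hm : 0 < m)
    (hHw : ∀ (y : Site (d + 1)) (κ : Fin (d + 1)) (u : Site (d + 1)),
      ∑ μ, (colH X Lc μ (y - unitVec μ) κ u - colH X Lc μ y κ u) = cH * gaugeWt Lc y κ u)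
    (hMw : ∀ (y : Site (d + 1)) (ρ : Fin (d + 1)) (w : Site (d + 1)), ∑ μ, (colM X Lc μ (y - unitVec μ) ρ w - colM X Lc μ y ρ w) = 0)
    (hXsg : trK X = sgnK X) (hXoff : ∀ (w z : Site (d + 1)) (ρ μ : Fin (d + 1)), Torus.proj Lc w ≠ 0 → X w z (Sum.inr ρ) (Sum.inr μ) = 0)
    {P : ℕ} (hP : 1 ≤ P) {S M : Fin (d + 1) → Site (d + 1) → MKer (d + 1) (Fib d)}
    {W : Fin (d + 1) → Site (d + 1) → Fin (d + 1) → Site (d + 1) → MKer (d + 1) (Fib d)} {B : Tab d} (c cB : ℝ)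
    (hb : ∀ (κ : Fin (d + 1)) (y : Site (d + 1)), Loc (dM X Lc S M κ y))
    (hW : ∀ (κ : Fin (d + 1)) (y : Site (d + 1)) (κ' : Fin (d + 1)) (y' : Site (d + 1)), Loc (W κ y κ' y'))
    (hBff : ∀ κ u κ' u' x z (α β : Fin (d + 1)), B κ u κ' u' x z (Sum.inl α) (Sum.inl β) = 0) (μ ν α β : Fin (d + 1)) :
    ∑ r' ∈ box (d + 1) P, ∑' u' : Site (d + 1), ∑' x : Site (d + 1), ∑' z : Site (d + 1),
        (if toSite r' μ % (P : ℤ) = (P : ℤ) - 1 ∧ u' ν % (P : ℤ) = (P : ℤ) - 1 ∧ x α % (P : ℤ) = (P : ℤ) - 1 ∧ z β % (P : ℤ) = (P : ℤ) - 1 then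
          (c • mmRead Lc (K3OfK X Lc S M W μ (toSite r') ν u') + cB • B μ (toSite r') ν u') x z (Sum.inl α) (Sum.inl β) else 0) =
      c * -(cH * cH) * ∑ r' ∈ box (d + 1) P, ∑' u' : Site (d + 1),
        (if toSite r' μ % (P : ℤ) = (P : ℤ) - 1 ∧ u' ν % (P : ℤ) = (P : ℤ) - 1 then
          ((∑' yw : Site (d + 1) × Site (d + 1),
              (if yw.1 α % ((Lc : ℤ) * (P : ℤ)) = (Lc : ℤ) * (P : ℤ) - 1 then (1 : ℝ) else 0) * (if yw.2 β % ((Lc : ℤ) * (P : ℤ)) = (Lc : ℤ) * (P : ℤ) - 1 then (1 : ℝ) else 0) *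
                comp (comp (dM X Lc S M μ (toSite r')) X) (dM X Lc S M ν u') yw.1 yw.2 (Sum.inl α) (Sum.inl β)) +
          (∑' yw : Site (d + 1) × Site (d + 1),
              (if yw.1 α % ((Lc : ℤ) * (P : ℤ)) = (Lc : ℤ) * (P : ℤ) - 1 then (1 : ℝ) else 0) * (if yw.2 β % ((Lc : ℤ) * (P : ℤ)) = (Lc : ℤ) * (P : ℤ) - 1 then (1 : ℝ) else 0) *
                comp (comp (dM X Lc S M ν u') X) (dM X Lc S M μ (toSite r')) yw.1 yw.2 (Sum.inl α) (Sum.inl β)) -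
          (∑' yw : Site (d + 1) × Site (d + 1),
              (if yw.1 α % ((Lc : ℤ) * (P : ℤ)) = (Lc : ℤ) * (P : ℤ) - 1 then (1 : ℝ) else 0) * (if yw.2 β % ((Lc : ℤ) * (P : ℤ)) = (Lc : ℤ) * (P : ℤ) - 1 then (1 : ℝ) else 0) *
                W μ (toSite r') ν u' yw.1 yw.2 (Sum.inl α) (Sum.inl β)))
        else 0) := by
  classical
  have hχ : ∀ s : ℤ, |(fun s : ℤ => if s % (P : ℤ) = (P : ℤ) - 1 then (1 : ℝ) else 0) s| ≤ 1 := by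
    intro s; simp only; split_ifs <;> simp
  rw [Finset.mul_sum]
  refine Finset.sum_congr rfl fun r' _ => ?_
  rw [← tsum_mul_left]
  refine tsum_congr fun u' => ?_
  by_cases hA : toSite r' μ % (P : ℤ) = (P : ℤ) - 1
  · by_cases hB : u' ν % (P : ℤ) = (P : ℤ) - 1
    · simp only [hA, hB, true_and, if_true]
      have h := hasSum_mmRead_K3OfK_weight_of_ward hX hm hHw hMw hXsg hXoff (hb μ (toSite r')) (hb ν u') (hW μ (toSite r') ν u') α β
        (fun s : ℤ => if s % (P : ℤ) = (P : ℤ) - 1 then (1 : ℝ) else 0) (fun s : ℤ => if s % (P : ℤ) = (P : ℤ) - 1 then (1 : ℝ) else 0) hχ hχ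
      have hpt : ∀ x z : Site (d + 1), (if x α % (P : ℤ) = (P : ℤ) - 1 ∧ z β % (P : ℤ) = (P : ℤ) - 1 then
            (c • mmRead Lc (K3OfK X Lc S M W μ (toSite r') ν u') + cB • B μ (toSite r') ν u') x z (Sum.inl α) (Sum.inl β) else 0) =
          c * ((fun s : ℤ => if s % (P : ℤ) = (P : ℤ) - 1 then (1 : ℝ) else 0) (x α) * (fun s : ℤ => if s % (P : ℤ) = (P : ℤ) - 1 then (1 : ℝ) else 0) (z β) *
            mmRead Lc (K3OfK X Lc S M W μ (toSite r') ν u') x z (Sum.inl α) (Sum.inl β)) := by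
        intro x z
        rw [ite_and_and_eq]
        simp only [Pi.add_apply, Pi.smul_apply, smul_eq_mul, hBff, mul_zero, add_zero]
        ring
      simp only [hpt, tsum_mul_left]
      rw [← h.summable.tsum_prod, h.tsum_eq, readout_eq_deepFF_const hP, readout_eq_deepFF_const hP, readout_eq_deepFF_const hP]
      ring
    · simp [hA, hB]
  · simp [hA]

end Ward

/-! ## §3 The (III′) instance `X̃′_j = unitK s_f s_m (GcombSh Lc j)` -/

section CombStep

variable (Lc)

/-- [folklore] **(SG) FOR THE COMB-CHART DRESSED STEP**: `trK X̃′_j = sgnK X̃′_j` (an2's `trK_GcombSh` through leaf-02 g53's `trK_unitK_eq_sgnK`). -/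
theorem trK_combStep (sf sm : ℝ) (j : ℕ) : trK (unitK sf sm (GcombSh (d := d) Lc j)) = sgnK (unitK sf sm (GcombSh (d := d) Lc j)) :=
  trK_unitK_eq_sgnK (trK_GcombSh (d := d) (Lc := Lc) j) sf sm

/-- [folklore] **(MO) FOR THE COMB-CHART DRESSED STEP** (an2's `GcombSh_inr_inr_off`; the units are diagonal). -/
theorem combStep_inr_inr_off (sf sm : ℝ) (j : ℕ) (w z : Site (d + 1)) (ρ μ : Fin (d + 1)) (hw : Torus.proj Lc w ≠ 0) :
    unitK sf sm (GcombSh (d := d) Lc j) w z (Sum.inr ρ) (Sum.inr μ) = 0 := by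
  rw [HessKerDressedUnits.unitK_apply, GcombSh_inr_inr_off (d := d) (Lc := Lc) j w hw z ρ μ, mul_zero, zero_mul]

/-- NOT IN PRINT; OUR BOOKKEEPING.  **(III′) — THE WEIGHTED TWO-FACE READ-OUT OF `K3OfK` THROUGH THE COMB-CHART DRESSED STEP** (every `j`, ANY units; constant `s_f·s_m·cH_j`,
`cH_j = (stepScale d Lc j·Lc^{d+1})⁻¹`) — the (III′) twin of leaf-06 K6b `hasSum_mmRead_K3OfK_dressedStep_weight`. -/
theorem hasSum_mmRead_K3OfK_combStep_weight (sf sm : ℝ) (j : ℕ)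
    {S M : Fin (d + 1) → Site (d + 1) → MKer (d + 1) (Fib d)}
    {W : Fin (d + 1) → Site (d + 1) → Fin (d + 1) → Site (d + 1) → MKer (d + 1) (Fib d)} {μ ν : Fin (d + 1)} {y y' : Site (d + 1)}
    (hb : Loc (dM (unitK sf sm (GcombSh (d := d) Lc j)) Lc S M μ y)) (hb' : Loc (dM (unitK sf sm (GcombSh (d := d) Lc j)) Lc S M ν y'))
    (hW : Loc (W μ y ν y')) (α β : Fin (d + 1)) (f g : ℤ → ℝ) {Bf Bg : ℝ} (hf : ∀ s, |f s| ≤ Bf) (hg : ∀ s, |g s| ≤ Bg) :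
    HasSum (fun xz : Site (d + 1) × Site (d + 1) =>
        f (xz.1 α) * g (xz.2 β) * mmRead Lc (K3OfK (unitK sf sm (GcombSh (d := d) Lc j)) Lc S M W μ y ν y') xz.1 xz.2 (Sum.inl α) (Sum.inl β))
      ((∑' yw : Site (d + 1) × Site (d + 1), ∑ φ' : Fib d, ∑ γ' : Fib d,
          Sum.elim (fun a => if a = α ∧ yw.1 α % (Lc : ℤ) = (Lc : ℤ) - 1 then -((sf * sm * (stepScale d Lc j * (Lc : ℝ) ^ (d + 1))⁻¹) * f (blk Lc yw.1 α)) else 0)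
              (fun _ => (0 : ℝ)) φ' *
            comp (comp (dM (unitK sf sm (GcombSh (d := d) Lc j)) Lc S M μ y) (unitK sf sm (GcombSh (d := d) Lc j))) (dM (unitK sf sm (GcombSh (d := d) Lc j)) Lc S M ν y')
              yw.1 yw.2 φ' γ' *
          Sum.elim (fun b' => if b' = β ∧ yw.2 β % (Lc : ℤ) = (Lc : ℤ) - 1 then (sf * sm * (stepScale d Lc j * (Lc : ℝ) ^ (d + 1))⁻¹) * g (blk Lc yw.2 β) else 0)
              (fun _ => (0 : ℝ)) γ') +
        (∑' yw : Site (d + 1) × Site (d + 1), ∑ φ' : Fib d, ∑ γ' : Fib d,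
          Sum.elim (fun a => if a = α ∧ yw.1 α % (Lc : ℤ) = (Lc : ℤ) - 1 then -((sf * sm * (stepScale d Lc j * (Lc : ℝ) ^ (d + 1))⁻¹) * f (blk Lc yw.1 α)) else 0)
              (fun _ => (0 : ℝ)) φ' *
            comp (comp (dM (unitK sf sm (GcombSh (d := d) Lc j)) Lc S M ν y') (unitK sf sm (GcombSh (d := d) Lc j))) (dM (unitK sf sm (GcombSh (d := d) Lc j)) Lc S M μ y)
              yw.1 yw.2 φ' γ' *
          Sum.elim (fun b' => if b' = β ∧ yw.2 β % (Lc : ℤ) = (Lc : ℤ) - 1 then (sf * sm * (stepScale d Lc j * (Lc : ℝ) ^ (d + 1))⁻¹) * g (blk Lc yw.2 β) else 0)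
              (fun _ => (0 : ℝ)) γ') -
        ∑' yw : Site (d + 1) × Site (d + 1), ∑ φ' : Fib d, ∑ γ' : Fib d,
          Sum.elim (fun a => if a = α ∧ yw.1 α % (Lc : ℤ) = (Lc : ℤ) - 1 then -((sf * sm * (stepScale d Lc j * (Lc : ℝ) ^ (d + 1))⁻¹) * f (blk Lc yw.1 α)) else 0)
              (fun _ => (0 : ℝ)) φ' *
            W μ y ν y' yw.1 yw.2 φ' γ' *
          Sum.elim (fun b' => if b' = β ∧ yw.2 β % (Lc : ℤ) = (Lc : ℤ) - 1 then (sf * sm * (stepScale d Lc j * (Lc : ℝ) ^ (d + 1))⁻¹) * g (blk Lc yw.2 β) else 0)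
              (fun _ => (0 : ℝ)) γ') := by
  obtain ⟨δ, C, hδ, _, hK⟩ := decays_GcombSh (d := d) Lc j
  exact hasSum_mmRead_K3OfK_weight_of_ward (decays_unitK hK) hδ
    (colH_ward_unitK (fun y κ u => colH_ward_GcombSh (d := d) (Lc := Lc) j y κ u) sf sm)
    (colM_ward_unitK (fun y ρ w => colM_GcombSh_ward (d := d) (Lc := Lc) j y ρ w) sf sm)
    (trK_combStep Lc sf sm j) (fun w z ρ μ hw => combStep_inr_inr_off Lc sf sm j w z ρ μ hw) hb hb' hW α β f g hf hg

/-- NOT IN PRINT; OUR BOOKKEEPING.  **(III′) — THE FACE READ AT COARSE PERIOD `P` OF THE COMB-CHART DRESSED ONE-STEP SOURCE** (every `j`, ANY units, `1 ≤ P`):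
`Σ_{r′∈box P} Σ'_{u′} Σ'_x Σ'_z [faces]_P·(c • mmRead Lc (K3OfK X̃′_j Lc S M W μ r′ ν u′) + cB • B μ r′ ν u′) x z (inl α)(inl β) = c·(−((s_f s_m)cH_j)²)·Σ_{r′,u′}[faces]·(direct + swapped − W)`
— the (III′) twin of MY Part 47 `faceRead_dressedSource_inl_inl` (leaf-06 K6c at every period, at the comb-chart data). -/
theorem faceRead_combSource_inl_inl (sf sm : ℝ) (j : ℕ) {P : ℕ} (hP : 1 ≤ P)
    {S M : Fin (d + 1) → Site (d + 1) → MKer (d + 1) (Fib d)}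
    {W : Fin (d + 1) → Site (d + 1) → Fin (d + 1) → Site (d + 1) → MKer (d + 1) (Fib d)} {B : Tab d} (c cB : ℝ)
    (hb : ∀ (κ : Fin (d + 1)) (y : Site (d + 1)), Loc (dM (unitK sf sm (GcombSh (d := d) Lc j)) Lc S M κ y))
    (hW : ∀ (κ : Fin (d + 1)) (y : Site (d + 1)) (κ' : Fin (d + 1)) (y' : Site (d + 1)), Loc (W κ y κ' y'))
    (hBff : ∀ κ u κ' u' x z (α β : Fin (d + 1)), B κ u κ' u' x z (Sum.inl α) (Sum.inl β) = 0) (μ ν α β : Fin (d + 1)) :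
    ∑ r' ∈ box (d + 1) P, ∑' u' : Site (d + 1), ∑' x : Site (d + 1), ∑' z : Site (d + 1),
        (if toSite r' μ % (P : ℤ) = (P : ℤ) - 1 ∧ u' ν % (P : ℤ) = (P : ℤ) - 1 ∧ x α % (P : ℤ) = (P : ℤ) - 1 ∧ z β % (P : ℤ) = (P : ℤ) - 1 then
          (c • mmRead Lc (K3OfK (unitK sf sm (GcombSh (d := d) Lc j)) Lc S M W μ (toSite r') ν u') + cB • B μ (toSite r') ν u') x z (Sum.inl α) (Sum.inl β)
        else 0) =
      c * -((sf * sm * (stepScale d Lc j * (Lc : ℝ) ^ (d + 1))⁻¹) * (sf * sm * (stepScale d Lc j * (Lc : ℝ) ^ (d + 1))⁻¹)) *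
        ∑ r' ∈ box (d + 1) P, ∑' u' : Site (d + 1),
        (if toSite r' μ % (P : ℤ) = (P : ℤ) - 1 ∧ u' ν % (P : ℤ) = (P : ℤ) - 1 then
          ((∑' yw : Site (d + 1) × Site (d + 1),
              (if yw.1 α % ((Lc : ℤ) * (P : ℤ)) = (Lc : ℤ) * (P : ℤ) - 1 then (1 : ℝ) else 0) * (if yw.2 β % ((Lc : ℤ) * (P : ℤ)) = (Lc : ℤ) * (P : ℤ) - 1 then (1 : ℝ) else 0) *
                comp (comp (dM (unitK sf sm (GcombSh (d := d) Lc j)) Lc S M μ (toSite r')) (unitK sf sm (GcombSh (d := d) Lc j)))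
                  (dM (unitK sf sm (GcombSh (d := d) Lc j)) Lc S M ν u') yw.1 yw.2 (Sum.inl α) (Sum.inl β)) +
          (∑' yw : Site (d + 1) × Site (d + 1),
              (if yw.1 α % ((Lc : ℤ) * (P : ℤ)) = (Lc : ℤ) * (P : ℤ) - 1 then (1 : ℝ) else 0) * (if yw.2 β % ((Lc : ℤ) * (P : ℤ)) = (Lc : ℤ) * (P : ℤ) - 1 then (1 : ℝ) else 0) *
                comp (comp (dM (unitK sf sm (GcombSh (d := d) Lc j)) Lc S M ν u') (unitK sf sm (GcombSh (d := d) Lc j)))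
                  (dM (unitK sf sm (GcombSh (d := d) Lc j)) Lc S M μ (toSite r')) yw.1 yw.2 (Sum.inl α) (Sum.inl β)) -
          (∑' yw : Site (d + 1) × Site (d + 1),
              (if yw.1 α % ((Lc : ℤ) * (P : ℤ)) = (Lc : ℤ) * (P : ℤ) - 1 then (1 : ℝ) else 0) * (if yw.2 β % ((Lc : ℤ) * (P : ℤ)) = (Lc : ℤ) * (P : ℤ) - 1 then (1 : ℝ) else 0) *
                W μ (toSite r') ν u' yw.1 yw.2 (Sum.inl α) (Sum.inl β)))
        else 0) := by
  obtain ⟨δ, C, hδ, _, hK⟩ := decays_GcombSh (d := d) Lc j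
  exact faceRead_source_inl_inl_of_ward (decays_unitK hK) hδ
    (colH_ward_unitK (fun y κ u => colH_ward_GcombSh (d := d) (Lc := Lc) j y κ u) sf sm)
    (colM_ward_unitK (fun y ρ w => colM_GcombSh_ward (d := d) (Lc := Lc) j y ρ w) sf sm)
    (trK_combStep Lc sf sm j) (fun w z ρ μ hw => combStep_inr_inr_off Lc sf sm j w z ρ μ hw) hP c cB hb hW hBff μ ν α β

end CombStep

end Summit.QuantumFields.BalabanUV.Beta.GAN24.FaceChargesOfWardLetters

end
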